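import Summits.AtomisticToContinuum.BoseEinsteinCondensation.Theses.BECInsertionCorrector
import Summits.AtomisticToContinuum.BoseEinsteinCondensation.Theses.BECPhaseQuadratureSumRule
import Summits.AtomisticToContinuum.BoseEinsteinCondensation.Theorems.BECInsertionCorrectorCorrectorClosureLongWaveStructureOfSRB
import Summits.AtomisticToContinuum.BoseEinsteinCondensation.Theorems.BECInsertionCorrectorCorrectorClosureDensityUniformDichotomy
import Summits.AtomisticToContinuum.BoseEinsteinCondensation.Theorems.BECInsertionCorrectorCorrectorClosureVolumeBootstrap
import Summits.AtomisticToContinuum.BoseEinsteinCondensation.Theorems.BECInsertionCorrectorCorrectorClosureRemovalEnergyBudget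
import Summits.AtomisticToContinuum.BoseEinsteinCondensation.Theorems.BECInsertionCorrectorCorrectorClosureResponseDictionaryMollifier
import Summits.AtomisticToContinuum.BoseEinsteinCondensation.Theorems.CorrectorClosure.Negative.KacClosureHMinusOneSingleMode
import Summits.AtomisticToContinuum.BoseEinsteinCondensation.Theorems.BECConjugateDominationNearMinimiserStabilityProof
import Summits.AtomisticToContinuum.BoseEinsteinCondensation.Theorems.BECPhaseQuadratureSumRuleMinimiserRegularity
import Literature.MathematicalPhysics.QuantumManyBody.BoseGasThermodynamicLimitProofs
import Summits.AtomisticToContinuum.BoseEinsteinCondensation.Theorems.StaticResponseBound.Negative.Basic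
import Literature.MathematicalPhysics.QuantumManyBody.WeightedCorrector
import HarnessLib

/-!
# Crux `CorrectorClosure` (stmt-AtomisticToContinuum-12058), line `volume-homotopy-sum-rule-domination` —
# the two sorry-free REDUCTIONS of skeleton v2, made importable

Supports (does not close) stmt-AtomisticToContinuum-12058, route `BECInsertionCorrector`.

Lead a5 (thirteenth seat).  Wave 1 of the picked line landed its three mechanism stubs
(`stub_longWaveStructureOfSRB` p134130 — the ONLY place K1 = `StaticResponseBound` is consumed,
`stub_densityUniformDichotomy` p135138 — PQSR's proved engine at coupling `t = 1` in local-density dress,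
`stub_volumeBootstrap` p135959 — Kato-free continuity in the side `L` + dilute anchor + connectedness) and
the first brick of the removal module (`stub_removalEnergyBudget` p135833).  This file kernel-certifies what
is left, as two theorems whose hypotheses are EXACTLY the open stub signatures of skeleton v2
(`Cruxes/CorrectorClosure/Lines/volume_homotopy_sum_rule_domination.lean`, commit cb08af6fd963), per potential:

* `periodicBEC_of_densityUniformHearts` — **K1 ∧ 12615′(v) ∧ 12616′(v) ⊢ torus BEC of near-minimisers at `v`**
  (the body of `PeriodicBEC`, item 8997, with `c = 1/2`) for every smooth-class `v`: the density-uniform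
  non-condensate remainders (S2 = PQSR item 12615 at `t = 1`, `∀ L ≥ sideLength ρ₀ N`) and the
  density-uniform condensate-number concentration (S3 = PQSR item 12616 likewise) are the ONLY open inputs
  of the volume homotopy; S4 fed with S1 (K1), S2, S3 gives the dichotomy `n₀ ∉ (N/4, 3N/4)` on
  `[sideLength ρ₀ N, ∞)`, S5 the floor `n₀ ≥ 3N/4` for the minimiser at `L = sideLength ρ N`
  (`minimiserRegularity_proof`, 12619), and `NearMinimiserStability` (11788) at `ε = 1/4` the window.
* `removalFidelity_of_regularRemovalSusceptibility` — **R(v) ⊢ RemovalFidelity(v)** for bounded `v`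
  (the `hFid` factor of `correctorClosure_of_factors`, p122159, with `c₂ = 1 − √η`): the zero-mode removal
  module of the sibling line `zero-mode-removal-susceptibility` with its first moment DISCHARGED
  (`stub_removalEnergyBudget`, B) — Kipnis–Varadhan's criterion `sq_integral_sq_le_of_hMinusOneSqW_le`
  applied to the centred removal ratio `g_c = G/Θ₀ − ⟨Θ₀,G⟩`, the Pythagoras identity
  `vhr_integral_centredRatio_sq`, and the regular zero-mode removal susceptibility R
  (`μ_{N+1}‖g_c‖²₋₁ ≤ η∫G²`, `η < 1`, OPEN) as hypothesis.  K1 is not used here.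

With these two theorems the crux reads, kernel-checked (composition in the companion file
`…VolumeHomotopyReduction.lean`): `CorrectorClosure ⇐ [∀ smooth v: 12615′ ∧ 12616′] ∧ [∀ bounded v: R] ∧
[non-smooth-class hole S7]`, with K1 doing density-sector work inside the first bracket.

References: the line card and skeleton (above); Lieb–Seiringer–Solovej–Yngvason (2005) Ch. 5; Stringari,
J. Low Temp. Phys. 84 (1991) / Phys. Rev. B (1995) §2.3 (sum rules); Kipnis–Landim (1999) App. 1 §6
(`H₋₁` variational formula); Reed–Simon IV §XIII.12 (nondegenerate ground states).
-/

noncomputable section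

open MeasureTheory Filter Matrix
open scoped ENNReal NNReal BigOperators ComplexConjugate

namespace Summit.AtomisticToContinuum.BoseEinsteinCondensation.Theorems.CorrectorClosure.VolumeHomotopySumRuleDomination

open Literature.MathematicalPhysics.QuantumManyBody.BoseGas
open Summit.AtomisticToContinuum.BoseEinsteinCondensation.Theses.BECInsertionCorrector
open Summit.AtomisticToContinuum.BoseEinsteinCondensation.Theorems
  (phaseQuadrature_nearMinimiserStability_proof minimiserRegularity_proof)
open Summit.AtomisticToContinuum.BoseEinsteinCondensation.Theorems.CorrectorClosure.Negative
  (sideLength_succ_pos sq_integral_sq_le_of_hMinusOneSqW_le)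
open Summit.AtomisticToContinuum.BoseEinsteinCondensation.Theorems.StaticResponseBound.Negative
  (sideLength_pos)
open Summit.AtomisticToContinuum.BoseEinsteinCondensation.Theorems.CorrectorClosure.ZeroModeRemovalSusceptibility
  (stub_removalEnergyBudget)
open Summit.AtomisticToContinuum.BoseEinsteinCondensation.Theorems.CorrectorClosure.HealingScaleKacInsertion.ResponseDictionary
  (integral_sq_eq_one_of_fk)

/-! ## Reduction 1: K1 ∧ 12615′(v) ∧ 12616′(v) ⊢ torus BEC at a smooth-class `v` -/

/-- **Torus BEC on the smooth class from K1 and the two density-uniform hearts (kernel-checked volume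
homotopy).** Given `StaticResponseBound`, a smooth-class `v`, the density-uniform non-condensate remainder
bound at `v` (`hR`, = stub S2 = PQSR item 12615 at `t = 1` with `∀ L ≥ sideLength ρ₀ N`) and the
density-uniform condensate-number concentration at `v` (`hC`, = stub S3 = PQSR item 12616 likewise): there
is `ρ₀ > 0` such that for `0 < ρ < ρ₀`, for all large `N`, some `δ > 0` makes every periodic
`δ`-near-minimiser `Ψ` on the torus of side `(N/ρ)^{1/3}` satisfy `condensateOccupation ≥ N/2` — the body of
`PeriodicBEC` (item 8997) at `v` with `c = 1/2`. Proof: `stub_densityUniformDichotomy` (p135138) fed with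
`stub_longWaveStructureOfSRB hK1` (p134130), `hR`, `hC` gives the dichotomy beyond an `N`-threshold on
`[sideLength ρ₀ N, ∞) ∋ sideLength ρ N` (`sideLength_le_sideLength`); `stub_volumeBootstrap` (p135959) turns
it into `n₀ ≥ 3N/4` for the minimiser at `sideLength ρ N` (`minimiserRegularity_proof`);
`phaseQuadrature_nearMinimiserStability_proof` at `ε = 1/4` gives the window. [folklore] -/
theorem periodicBEC_of_densityUniformHearts (hK1 : StaticResponseBound) (v : ℝ → ℝ≥0∞)
    (hv : IsRepulsiveFiniteRange v) (hfin : ∀ r, v r ≠ ⊤)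
    (hC2 : ContDiff ℝ 2 (fun x : Space => (v ‖x‖).toReal))
    (hedge : ∃ Cₑ : ℝ, ∀ x : Space,
      ‖iteratedFDeriv ℝ 2 (fun x : Space => (v ‖x‖).toReal) x‖ ≤ Cₑ * Real.sqrt ((v ‖x‖).toReal))
    (hR : ∀ Λ : ℝ, 0 < Λ → ∀ ε : ℝ, 0 < ε → ∃ ρ₀ : ℝ, 0 < ρ₀ ∧ ∀ᶠ N : ℕ in atTop, ∀ L : ℝ,
      sideLength ρ₀ N ≤ L → ∀ Ψ : PeriodicTrialState N L,
      periodicEnergy v Ψ = periodicGroundStateEnergy v N L → periodicEnergy v Ψ ≠ ⊤ →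
      (∑' n : Fin 3 → ℤ,
      {n : Fin 3 → ℤ | n ≠ 0 ∧ ‖((2 * Real.pi / L) • latticeVec 1 n)‖ <
      Λ * Real.sqrt ((N : ℝ) / L ^ 3 * (scatteringLength v).toReal)}.indicator
      (fun n =>
      (∫⁻ X in cellN N L,
      (‖∑ j : Fin N,
      (cellWave L n (X j) *
      ((-2 * Complex.I) * fderiv ℝ Ψ.ψ X (Pi.single j ((2 * Real.pi / L) • latticeVec 1 n)) +
      (((‖((2 * Real.pi / L) • latticeVec 1 n)‖ ^ 2 : ℝ)) : ℂ) *
      (Ψ.ψ X - (((L ^ 3)⁻¹ : ℝ) : ℂ) * ∫ y in cell L, Ψ.ψ (Function.update X j y))) +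
      (((‖((2 * Real.pi / L) • latticeVec 1 n)‖ ^ 2 : ℝ)) : ℂ) *
      ((((L ^ 3)⁻¹ : ℝ) : ℂ) *
      ∫ y in cell L, cellWave L n y * Ψ.ψ (Function.update X j y)))‖₊ : ℝ≥0∞) ^ 2) /
      ENNReal.ofReal (‖((2 * Real.pi / L) • latticeVec 1 n)‖ ^ 4) +
      (∫⁻ X in cellN N L,
      (‖∑ j : Fin N,
      (cellWave L n (X j) *
      (Ψ.ψ X - (((L ^ 3)⁻¹ : ℝ) : ℂ) * ∫ y in cell L, Ψ.ψ (Function.update X j y)) -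
      (((L ^ 3)⁻¹ : ℝ) : ℂ) *
      ∫ y in cell L, cellWave L n y * Ψ.ψ (Function.update X j y))‖₊ : ℝ≥0∞) ^ 2))
      n) ≤
      ENNReal.ofReal (ε * (N : ℝ) ^ 2))
    (hC : ∀ ζ : ℝ, 0 < ζ → ∃ ρ₀ : ℝ, 0 < ρ₀ ∧ ∀ᶠ n : ℕ in atTop, ∀ L : ℝ, sideLength ρ₀ (n + 2) ≤ L →
      ∀ Ψ : PeriodicTrialState (n + 2) L,
      periodicEnergy v Ψ = periodicGroundStateEnergy v (n + 2) L → periodicEnergy v Ψ ≠ ⊤ →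
      ((n + 2 : ℕ) : ℝ≥0∞) * ((n + 1 : ℕ) : ℝ≥0∞) *
      (∫⁻ Y in cellN n L,
      (‖∫ x in cell L, ∫ y in cell L, Ψ.ψ (vecCons x (vecCons y Y))‖₊ : ℝ≥0∞) ^ 2) /
      ENNReal.ofReal (L ^ 6) +
      condensateOccupation (n + 2) L Ψ.ψ ≤
      condensateOccupation (n + 2) L Ψ.ψ ^ 2 + ENNReal.ofReal (ζ * ((n : ℝ) + 2) ^ 2)) :
    ∃ ρ₀ : ℝ, 0 < ρ₀ ∧ ∀ ρ : ℝ, 0 < ρ → ρ < ρ₀ → ∃ c : ℝ, 0 < c ∧ ∀ᶠ N : ℕ in atTop,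
      ∃ δ : ℝ≥0∞, 0 < δ ∧ ∀ Ψ : PeriodicTrialState N (sideLength ρ N),
        periodicEnergy v Ψ ≤ periodicGroundStateEnergy v N (sideLength ρ N) + δ →
        ENNReal.ofReal (c * N) ≤ condensateOccupation N (sideLength ρ N) Ψ.ψ := by
  obtain ⟨ρ₀, hρ₀, hev⟩ := stub_densityUniformDichotomy v hv hfin hC2 hedge
    (stub_longWaveStructureOfSRB hK1 v hv hfin hC2 hedge) hR hC
  refine ⟨ρ₀, hρ₀, fun ρ hρ hρlt => ⟨1 / 2, by norm_num, ?_⟩⟩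
  filter_upwards [hev, eventually_gt_atTop 0] with N hN hNpos
  set L : ℝ := sideLength ρ N with hL_def
  have hL : 0 < L := sideLength_pos hρ hNpos
  have hL₀pos : 0 < sideLength ρ₀ N := sideLength_pos hρ₀ hNpos
  have hL₀ : sideLength ρ₀ N ≤ L := sideLength_le_sideLength hρ hρlt.le N
  -- the bootstrap on `[sideLength ρ₀ N, ∞)`: every minimiser there has `n₀ ≥ 3N/4`
  have h34 := stub_volumeBootstrap v hv hfin hC2 hedge N (sideLength ρ₀ N) hL₀pos
    (fun L' hL' Ψ hE hfinE => hN L' hL' Ψ hE hfinE)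
  -- a minimiser at `L = sideLength ρ N`
  obtain ⟨Ψm, hEm, hfinm, -⟩ := minimiserRegularity_proof v hv hfin hC2 hedge N hNpos L hL
  have hE₀ : periodicGroundStateEnergy v N L ≠ ⊤ := by rw [← hEm]; exact hfinm
  have hΨm : ENNReal.ofReal (3 * (N : ℝ) / 4) ≤ condensateOccupation N L Ψm.ψ :=
    h34 L hL₀ Ψm hEm hfinm
  -- stability of `n₀` under `δ`-near-minimisation at fixed `(N, L)`, `ε = 1/4`
  obtain ⟨δ, hδ, hstab⟩ := phaseQuadrature_nearMinimiserStability_proof v hv hfin hC2 hedge N L hL hE₀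
    (1 / 4) (by norm_num)
  refine ⟨δ, hδ, fun Φ hΦ => ?_⟩
  have hst : condensateOccupation N L Ψm.ψ ≤
      condensateOccupation N L Φ.ψ + ENNReal.ofReal (1 / 4 * (N : ℝ)) := hstab Ψm Φ hEm hΦ
  have hsplit : ENNReal.ofReal (3 * (N : ℝ) / 4) =
      ENNReal.ofReal (1 / 2 * (N : ℝ)) + ENNReal.ofReal (1 / 4 * (N : ℝ)) := by
    rw [← ENNReal.ofReal_add (by positivity) (by positivity)]
    congr 1; ring
  have h2 : ENNReal.ofReal (1 / 2 * (N : ℝ)) + ENNReal.ofReal (1 / 4 * (N : ℝ)) ≤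
      condensateOccupation N L Φ.ψ + ENNReal.ofReal (1 / 4 * (N : ℝ)) := by
    rw [← hsplit]; exact hΨm.trans hst
  exact (ENNReal.add_le_add_iff_right ENNReal.ofReal_ne_top).1 h2

/-! ## Reduction 2: R(v) ⊢ the removal-fidelity factor at a bounded `v` (K1-free) -/

/-- **The removal Pythagoras identity.** For a cell-normalised continuous positive weight `Θ₀`
(`∫_cell Θ₀² = 1`) and a continuous `G`, the `Θ₀²`-mass of the centred ratio `g_c = G/Θ₀ − ⟨Θ₀,G⟩` is
`‖G_⊥‖² = ∫G² − ⟨Θ₀,G⟩²`. [folklore] -/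
theorem vhr_integral_centredRatio_sq (L : ℝ) {N : ℕ} {Θ₀ G : Config N → ℝ} (hΘc : Continuous Θ₀)
    (hΘp : ∀ X, 0 < Θ₀ X) (hGc : Continuous G) (m : ℝ) (hm : ∫ X in cellN N L, Θ₀ X * G X = m)
    (hone : ∫ X in cellN N L, Θ₀ X ^ 2 = 1) :
    ∫ X in cellN N L, (G X / Θ₀ X - m) * (G X / Θ₀ X - m) * Θ₀ X ^ 2 =
      (∫ X in cellN N L, G X ^ 2) - m ^ 2 := by
  have hpt : ∀ X, (G X / Θ₀ X - m) * (G X / Θ₀ X - m) * Θ₀ X ^ 2 =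
      G X ^ 2 - 2 * m * (Θ₀ X * G X) + m ^ 2 * Θ₀ X ^ 2 := by
    intro X
    have hne : Θ₀ X ≠ 0 := (hΘp X).ne'
    have h1 : (G X / Θ₀ X - m) * Θ₀ X = G X - m * Θ₀ X := by
      rw [sub_mul, div_mul_cancel₀ _ hne]
    calc (G X / Θ₀ X - m) * (G X / Θ₀ X - m) * Θ₀ X ^ 2
        = ((G X / Θ₀ X - m) * Θ₀ X) * ((G X / Θ₀ X - m) * Θ₀ X) := by ring
      _ = (G X - m * Θ₀ X) * (G X - m * Θ₀ X) := by rw [h1]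
      _ = G X ^ 2 - 2 * m * (Θ₀ X * G X) + m ^ 2 * Θ₀ X ^ 2 := by ring
  simp_rw [hpt]
  have h1 : Integrable (fun X => G X ^ 2) (volume.restrict (cellN N L)) :=
    integrableOn_cellN (hGc.pow 2) L
  have h2 : Integrable (fun X => 2 * m * (Θ₀ X * G X)) (volume.restrict (cellN N L)) :=
    (integrableOn_cellN (hΘc.mul hGc) L).const_mul (2 * m)
  have h3 : Integrable (fun X => m ^ 2 * Θ₀ X ^ 2) (volume.restrict (cellN N L)) :=
    (integrableOn_cellN (hΘc.pow 2) L).const_mul (m ^ 2)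
  have h12 : Integrable (fun X => G X ^ 2 - 2 * m * (Θ₀ X * G X)) (volume.restrict (cellN N L)) :=
    h1.sub h2
  rw [integral_add h12 h3, integral_sub h1 h2, integral_const_mul, integral_const_mul, hm, hone]
  ring

/-- **The removal-fidelity factor from the two moments (v2: replaces S6 `stub_removalFidelity`; the sibling card's
`RemovalSandwich`, kernel-checked, copied verbatim from `Lines/zero_mode_removal_susceptibility.lean`).**
Stub B (first moment `𝓔_{Θ₀}(g,g) ≤ μ∫G²`) and Stub R (`μ‖g_c‖²₋₁ ≤ η∫G²`, `η < 1` uniform in `N`)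
give the `hFid` factor of `correctorClosure_of_factors` with `c₂ = 1 − √η`:
Kipnis–Varadhan's criterion (`sq_integral_sq_le_of_hMinusOneSqW_le`, Disproof §16) applied to the
centred ratio, `𝓔(g_c,g_c) = 𝓔(g,g)` (constants are `𝓔`-null), and the Pythagoras identity yield
`(∫G² − ⟨Θ₀,G⟩²)² ≤ η (∫G²)²`, i.e. `(1 − √η)∫G² ≤ ⟨Θ₀,G⟩²`. K1 is not used. [folklore] -/
theorem removalFidelity_of_regularRemovalSusceptibility (v : ℝ → ℝ≥0∞) (hv : IsRepulsiveFiniteRange v)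
    (hRRS : ∃ ρ₃ : ℝ, 0 < ρ₃ ∧ ∀ ρ : ℝ, 0 < ρ → ρ < ρ₃ → ∃ η : ℝ, 0 ≤ η ∧ η < 1 ∧
      ∀ᶠ N : ℕ in atTop, ∀ (L : ℝ), L = sideLength ρ (N + 1) →
      (∃ C : ℝ≥0, ∀ x, periodizedPotential v L x ≤ C) →
      ∀ (Θ₀ : Config N → ℝ), IsPeriodicGroundStateFK v L Θ₀ → Continuous Θ₀ → (∀ X, 0 < Θ₀ X) →
      ∀ (Φ₀ : Config (N + 1) → ℝ), IsPeriodicGroundStateFK v L Φ₀ → Continuous Φ₀ →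
      (∀ X, 0 < Φ₀ X) →
      ∀ (G : Config N → ℝ), (G = fun X => ∫ x in cell L, Φ₀ (vecCons x X)) →
      ∃ B : ℝ, 0 ≤ B ∧
      hMinusOneSqW L Θ₀ (fun X => G X / Θ₀ X - ∫ Y in cellN N L, Θ₀ Y * G Y) ≤
      ENNReal.ofReal B ∧
      ((periodicGroundStateEnergy v (N + 1) L).toReal
      - (periodicGroundStateEnergy v N L).toReal) * B ≤
      η * ∫ X in cellN N L, G X ^ 2) :
    ∃ ρ₃ : ℝ, 0 < ρ₃ ∧ ∀ ρ : ℝ, 0 < ρ → ρ < ρ₃ → ∃ c₂ : ℝ, 0 < c₂ ∧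
      ∀ᶠ N : ℕ in atTop, ∀ (L : ℝ), L = sideLength ρ (N + 1) →
        (∃ C : ℝ≥0, ∀ x, periodizedPotential v L x ≤ C) →
        ∀ (Θ₀ : Config N → ℝ), IsPeriodicGroundStateFK v L Θ₀ → Continuous Θ₀ → (∀ X, 0 < Θ₀ X) →
        ∀ (Φ₀ : Config (N + 1) → ℝ), IsPeriodicGroundStateFK v L Φ₀ → Continuous Φ₀ →
          (∀ X, 0 < Φ₀ X) →
        ∀ (G : Config N → ℝ), (G = fun X => ∫ x in cell L, Φ₀ (vecCons x X)) →
          ENNReal.ofReal c₂ * ∫⁻ X in cellN N L, ENNReal.ofReal (G X) ^ 2 ≤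
            ENNReal.ofReal ((∫ X in cellN N L, Θ₀ X * G X) ^ 2) := by
  obtain ⟨ρ₃, hρ₃, hR⟩ := hRRS
  refine ⟨ρ₃, hρ₃, fun ρ hρ hρlt => ?_⟩
  obtain ⟨η, hη0, hη1, hRη⟩ := hR ρ hρ hρlt
  have hsη : Real.sqrt η < 1 := by
    rw [← Real.sqrt_one]
    exact Real.sqrt_lt_sqrt hη0 hη1
  refine ⟨1 - Real.sqrt η, by linarith, ?_⟩
  filter_upwards [hRη] with N hRN L hL_def hb Θ₀ hΘ hΘc hΘp Φ₀ hΦ hΦc hΦp G hG_def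
  have hL : 0 < L := by
    rw [hL_def]
    exact sideLength_succ_pos hρ N
  -- Stub B: the ratio is a periodic test function and the first-moment budget
  obtain ⟨hg, hbudget⟩ := stub_removalEnergyBudget v hv N L hL hb Θ₀ hΘ hΘc hΘp Φ₀ hΦ hΦc hΦp G hG_def
  -- Stub R at this `N`
  obtain ⟨B, hB0, hH, hμB⟩ := hRN L hL_def hb Θ₀ hΘ hΘc hΘp Φ₀ hΦ hΦc hΦp G hG_def
  -- notation
  set μ : ℝ := (periodicGroundStateEnergy v (N + 1) L).toReal
      - (periodicGroundStateEnergy v N L).toReal with hμ_def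
  set m : ℝ := ∫ Y in cellN N L, Θ₀ Y * G Y with hm_def
  set S : ℝ := ∫ X in cellN N L, G X ^ 2 with hS_def
  set g : Config N → ℝ := fun X => G X / Θ₀ X with hg_def
  set gc : Config N → ℝ := fun X => G X / Θ₀ X - m with hgc_def
  -- positivity and continuity of the removal amplitude
  have hG0 : ∀ X, 0 ≤ G X := fun X => by
    rw [hG_def]
    exact setIntegral_nonneg (measurableSet_cell L) fun x _ => (hΦp _).le
  have hGc : Continuous G := by
    have h : Continuous fun X => g X * Θ₀ X := hg.continuous.mul hΘc
    have heq : (fun X => g X * Θ₀ X) = G := funext fun X => div_mul_cancel₀ (G X) (hΘp X).ne'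
    rwa [heq] at h
  have hS0 : 0 ≤ S := integral_nonneg fun X => sq_nonneg (G X)
  -- the centred ratio is a periodic test function with the same Dirichlet energy
  have hgc_eq : gc = g - fun _ => m := rfl
  have hgc : IsPeriodicTest L gc := by
    rw [hgc_eq]
    exact hg.sub (IsPeriodicTest.const L m)
  have hD : dirichletFormW L Θ₀ gc gc = dirichletFormW L Θ₀ g g := by
    rw [hgc_eq, dirichletFormW_sub_sub hΘc hg (IsPeriodicTest.const L m), dirichletFormW_const_right,
      dirichletFormW_const_left]
    ring
  -- Kipnis–Varadhan's criterion (the sandwich): `P² ≤ B · 𝓔(g_c, g_c)`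
  set P : ℝ := ∫ X in cellN N L, gc X * gc X * Θ₀ X ^ 2 with hP_def
  have hP0 : 0 ≤ P := integral_nonneg fun X => mul_nonneg (mul_self_nonneg _) (sq_nonneg _)
  have hKV : P ^ 2 ≤ B * dirichletFormW L Θ₀ gc gc := sq_integral_sq_le_of_hMinusOneSqW_le hgc hB0 hH
  -- combine with the two moment bounds: `P² ≤ η S²`
  have hP2 : P ^ 2 ≤ η * S ^ 2 := by
    calc P ^ 2 ≤ B * dirichletFormW L Θ₀ gc gc := hKV
      _ = B * dirichletFormW L Θ₀ g g := by rw [hD]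
      _ ≤ B * (μ * S) := mul_le_mul_of_nonneg_left hbudget hB0
      _ = (μ * B) * S := by ring
      _ ≤ (η * S) * S := mul_le_mul_of_nonneg_right hμB hS0
      _ = η * S ^ 2 := by ring
  have hPle : P ≤ Real.sqrt η * S := by
    have h1 : P ^ 2 ≤ (Real.sqrt η * S) ^ 2 := by
      rw [mul_pow, Real.sq_sqrt hη0]
      exact hP2
    calc P = Real.sqrt (P ^ 2) := (Real.sqrt_sq hP0).symm
      _ ≤ Real.sqrt ((Real.sqrt η * S) ^ 2) := Real.sqrt_le_sqrt h1
      _ = Real.sqrt η * S := Real.sqrt_sq (mul_nonneg (Real.sqrt_nonneg η) hS0)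
  -- Pythagoras: `P = S − m²`
  have hone : ∫ X in cellN N L, Θ₀ X ^ 2 = 1 := integral_sq_eq_one_of_fk hΘ hΘc hL
  have hPyth : P = S - m ^ 2 := vhr_integral_centredRatio_sq L hΘc hΘp hGc m hm_def.symm hone
  have h2 : S - m ^ 2 ≤ Real.sqrt η * S := by
    rw [← hPyth]
    exact hPle
  have hfloor : (1 - Real.sqrt η) * S ≤ m ^ 2 := by
    have h3 : (1 - Real.sqrt η) * S = S - Real.sqrt η * S := by ring
    rw [h3]
    linarith
  -- conversion to the `ℝ≥0∞` currency of the factor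
  have hGi : Integrable (fun X => G X ^ 2) (volume.restrict (cellN N L)) :=
    integrableOn_cellN (hGc.pow 2) L
  have hconv : ∫⁻ X in cellN N L, ENNReal.ofReal (G X) ^ 2 = ENNReal.ofReal S := by
    rw [hS_def, ofReal_integral_eq_lintegral_ofReal hGi (ae_of_all _ fun X => sq_nonneg (G X))]
    exact lintegral_congr fun X => (ENNReal.ofReal_pow (hG0 X) 2).symm
  rw [hconv, ← ENNReal.ofReal_mul (sub_nonneg.2 hsη.le)]
  exact ENNReal.ofReal_le_ofReal hfloor

end Summit.AtomisticToContinuum.BoseEinsteinCondensation.Theorems.CorrectorClosure.VolumeHomotopySumRuleDomination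

end
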